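import Summits.BirchSwinnertonDyer.BirchSwinnertonDyer.Theorems.RamifiedHeegnerPairLeafRankOneUpperAtThreeShimuraInertOddSupply
import Summits.BirchSwinnertonDyer.BirchSwinnertonDyer.Theorems.RamifiedHeegnerPairLeafRankOneUpperAtThreeShimuraInertOfLowerRankZero
import HarnessLib

/-!
# Route `RamifiedHeegnerPair`, crux U₁ `LeafRankOneUpperAtThree` (stmt-BirchSwinnertonDyer-26022), line `splitkolyvagin` —
# the INERT-CARRIER (Shimura-curve) road, part 5: THE COMPOSITION of skeleton v10 — the Shimura rows WITHOUT the `2 ∣ N` binder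

HONEST FRAMING. Theorems only; helper file (`--supports stmt-BirchSwinnertonDyer-26022 --as helper`); nothing is booked, no item is
closed, BSD is not proved for any curve; CONDITIONAL on every displayed input. Lead prover bsd-line-rhp-p2 g10, 2026-08-28. Sequel of
part 3 (p651044, skeleton v9) and part 4 (p652726: the odd-`d_K` twist supply `friedbergHoffstein_exists_twist_ne_zero_inertAt_splitAt`,
Friedberg–Hoffstein Thm. B in JSW 2017 §7.4.2's form (a)–(d), Literature p652724).

* `sigmaStarOptOffShimuraRowsAny_of_sigmaStarOptOffShimuraRows` — Σ★⁗ ⟹ Σ★⁵ (weakening: the Shimura-row clause loses its `2 ∣ N`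
  conjunct, so MORE rows are excluded from the research stub); hence 27493 ⟹ Σ★‴ ⟹ Σ★⁗ ⟹ Σ★⁵.
* `leafRankOneUpper_three_of_shimuraInertDatum_of_twistUnit` — the per-curve CERTIFICATE SHAPE (TU|inert): U₁ at one leaf curve on a
  Shimura row from the five named facts + ONE Jetchev–Skinner–Wan field whose twist has a `3`-adic-unit `#Ш_an` (no L-member, no Σ) — the
  instrument for trib-w's per-class census at JSW fields.
* `leafRankOneUpperAtThree_of_pubManin_of_namedFacts_of_shimuraFactsSplit_of_sigmaStarOptOffShimuraRowsAny_of_lowerRankZero` — THE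
  COMPOSITION of skeleton v10: `LeafRankOnePrintedInputsAtThree → F1 → F2 → F3 → JL → Pasten §6 → CST14+JSW17 → FH-inert-split → Σ★⁵ → L₀
  → LeafRankOneUpperAtThree`, as part 3 §4 with the Shimura branch served by part 4's `…_of_lowerRankZero_of_splitSupply`.

Census (rank-one Gss2, `N < 5·10⁵`): the Shimura rows of v10 = 116 of the 238 multi-carrier classes (123 with the `q = 2` cokernel
clause); Σ★⁵'s content = 109 classes with an additive `IV/IV*` carrier + 6 with both carriers `≡ 1 (mod 3)` (+7). BSD is not proved;
U₁ / L₀ / Σ★⁵ OPEN. References: [cite: JetchevSkinnerWan2017, §7.4.2 (p. 31), Thm. 4.4.1 (p. 19)] [cite: CaiShuTian2014, Thm. 1.5]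
[cite: PastenShimura2024, Prop. 6.13, Lemmas 6.8, 6.14–6.16, 6.18 (pp. 22–25)] [cite: FriedbergHoffstein1995, Thm. B]
[cite: Jetchev2008, Conj. 1.3, Thm. 1.4 (p. 812)] [cite: MatarNekovar2019, Thm. 0.7 (p. 456)] [cite: Miller2011LMS, Def. 1.1].
-/

-- D-0017: single-problem summit, so `Summit.BirchSwinnertonDyer.BirchSwinnertonDyer.…` repeats a namespace BY DESIGN.
set_option linter.dupNamespace false
set_option autoImplicit false

noncomputable section

open scoped Classical NumberField

open WeierstrassCurve NumberField IsDedekindDomain Literature Literature.NumberTheory.EllipticCurves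
  Rat.HeightOneSpectrum
  Literature.NumberTheory.EllipticCurves.ModularForms
  Literature.NumberTheory.EllipticCurves.Rank1Residual
  Literature.NumberTheory.EllipticCurves.Rank1Residual.Typed
  Literature.NumberTheory.QuadraticFields.Quadratic
  Literature.NumberTheory.Automorphic
  Summit.BirchSwinnertonDyer.Rank1Residual
  Summit.BirchSwinnertonDyer.Rank1Residual.Additive
  Summit.BirchSwinnertonDyer.Rank1Residual.X11b
  Summit.BirchSwinnertonDyer.Rank1Residual.X11b.Three
  Summit.BirchSwinnertonDyer.BirchSwinnertonDyer.Theses.RamifiedHeegnerPair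
  Summit.BirchSwinnertonDyer.BirchSwinnertonDyer.Theorems
  Summit.BirchSwinnertonDyer.BirchSwinnertonDyer.Theorems.RamifiedPairUpperBound

namespace Summit.BirchSwinnertonDyer.BirchSwinnertonDyer.Theorems.LeafShimuraInert

/-! ## §6b The per-curve CERTIFICATE SHAPE: a twist-unit partner at the Jetchev–Skinner–Wan field -/

/-- A rank-free triviality: if `#Ш_an(Wd)` is a rational `3`-adic NON-UNIT-FREE value (`ord₃ ≤ 0`), the lower half holds (`0 ≤ ord₃ #Ш`).
[cite: Miller2011LMS, Def. 1.1] -/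
theorem missingLowerBoundAt_of_shaAn_padicValRat_le_zero (Wd : WeierstrassCurve ℚ) {p : ℕ}
    (h : ∃ qd : ℚ, shaAn Wd = (qd : ℂ) ∧ padicValRat p qd ≤ 0) : Typed.MissingLowerBoundAt Wd p := by
  obtain ⟨qd, hqd, hle⟩ := h
  exact ⟨qd, hqd, hle.trans (by exact_mod_cast Nat.zero_le _)⟩

/-- **U₁ AT ONE LEAF CURVE ON A SHIMURA ROW FROM ONE TWIST-UNIT CERTIFICATE AT A JETCHEV–SKINNER–WAN FIELD (TU|inert) — the per-curve
instrument of the inert-carrier road.** Part 2 §1 with the partner's lower half DISCHARGED by a `3`-adic-unit analytic Sha of the twist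
(`ord₃ #Ш_an(Wd) ≤ 0` for the globally minimal models `Wd` of `W^{(d_K)}`): given the five named facts, a leaf `W` (`r_an = 1`) with a datum
`3 ∤ c`, the inert set `S`, SHAPE, (DEG)-availability, and ONE imaginary quadratic `K` (odd `d_K`, `S` inert, every other bad prime split,
`L(W^{(d_K)},1) ≠ 0`) whose twist has `3 ∤ #Ш_an` — `Typed.MissingUpperBoundAt W 3`, with NO L-member and NO Σ. The census instrument
for the 116 Shimura rows (trib-w's `heeg2.gp`/modular symbols at a JSW field instead of a split one). CONDITIONAL on the named facts; an
instance, never progress on the leaf. [cite: JetchevSkinnerWan2017, §7.4.2 (p. 31), Thm. 4.4.1 (p. 19)] [cite: CaiShuTian2014, Thm. 1.5]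
[cite: PastenShimura2024, Prop. 6.13, Lemmas 6.15–6.16, 6.18 (pp. 23–25)] [cite: Miller2011LMS, Def. 1.1] -/
theorem leafRankOneUpper_three_of_shimuraInertDatum_of_twistUnit
    -- published inputs (named facts of the tree)
    (hGZK : rank_eq_analyticRank_of_analyticRank_le_one) (hmod : hasEntireLFunction_rat)
    (hnf : exists_isNewformOf) (hJL : nonempty_shimuraParametrizationData)
    (hCO : PastenShimura2024_componentOrders)
    (hHK : shimuraCurve_heegnerPoint_grossZagier_kolyvagin)
    -- the leaf curve, with a datum whose constant is a `3`-unit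
    (W : WeierstrassCurve ℚ) [W.IsElliptic] [W.IsGloballyMinimal]
    (hadd : Addv W 3) (hsub : SubGss W 3) (hr : W.analyticRank = 1)
    {N : ℕ} [NeZero N] (hN : W.conductorNorm ℤ = N)
    (Dt : ModularParametrizationData W N) (hc : ¬ (3 : ℤ) ∣ Dt.c)
    -- the inert set, SHAPE and (DEG)-availability
    (S : Finset ℕ) (hSeven : Even S.card)
    (hSmult : ∀ ℓ ∈ S, ∃ _ : Fact ℓ.Prime, W.HasMultiplicativeReductionAtPrime ℓ)
    (hFC : ∀ (ℓ : ℕ) [Fact ℓ.Prime], ℓ ∉ S → W.HasSplitMultiplicativeReductionAtPrime ℓ →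
      ¬ 3 ∣ padicValInt ℓ W.minimalDiscriminantInt)
    (hshape : ∀ (q : ℕ) [Fact q.Prime], 3 ∣ (W.baseChange ℚ_[q]).localTamagawaNumber ℤ_[q] →
      W.HasSplitMultiplicativeReductionAtPrime q)
    (hDEG : (∃ ℓ₀ ∈ S, ¬ 3 ∣ padicValInt ℓ₀ W.minimalDiscriminantInt) ∨
      (∃ ℓ₀ t : ℕ, ∃ _ : Fact ℓ₀.Prime, ∃ _ : Fact t.Prime,
        W.HasMultiplicativeReductionAtPrime ℓ₀ ∧ W.HasMultiplicativeReductionAtPrime t ∧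
        ℓ₀ ∉ S ∧ t ∉ S ∧ t ≠ ℓ₀ ∧ ¬ 3 ∣ padicValInt ℓ₀ W.minimalDiscriminantInt) ∨
      (∃ q₁ q₂ : ℕ, S = {q₁, q₂} ∧ q₁ ≠ q₂ ∧ q₂ ≠ 2 ∧ q₂ % 3 ≠ 1))
    -- ONE Jetchev–Skinner–Wan field datum with a TWIST-UNIT certificate
    (K : Type) [Field K] [NumberField K] (hK : IsImaginaryQuadratic K) (hodd : Odd (NumberField.discr K))
    (hinert : ∀ ℓ ∈ S, ((Ideal.span {(ℓ : ℤ)}).primesOver (𝓞 K)).ncard = 1 ∧ ¬ (ℓ : ℤ) ∣ NumberField.discr K)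
    (hsplitN : ∀ ℓ : ℕ, ℓ.Prime → ℓ ∣ W.conductorNorm ℤ → ℓ ∉ S →
      ((Ideal.span {(ℓ : ℤ)}).primesOver (𝓞 K)).ncard = 2)
    (hLt : (W.quadraticTwist (NumberField.discr K : ℚ)).entireLFunction 1 ≠ 0)
    (hTU : ∀ (Wd : WeierstrassCurve ℚ) [Wd.IsElliptic] [Wd.IsGloballyMinimal] (Cd : VariableChange ℚ),
      Cd • W.quadraticTwist (NumberField.discr K : ℚ) = Wd → ∃ qd : ℚ, shaAn Wd = (qd : ℂ) ∧ padicValRat 3 qd ≤ 0) :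
    Typed.MissingUpperBoundAt W 3 :=
  leafRankOneUpper_three_of_shimuraInertDatum hGZK hmod hnf hJL hCO hHK W hadd hsub hr hN Dt hc S hSeven hSmult hFC hshape hDEG K hK
    hodd hinert hsplitN hLt (fun Wd _ _ Cd hWd ↦ missingLowerBoundAt_of_shaAn_padicValRat_le_zero Wd (hTU Wd Cd hWd))

/-! ## §7 Σ★⁗ ⟹ Σ★⁵ and the composition of skeleton v10 -/

/-- **Σ★⁗ ⟹ Σ★⁵** (weakening: Σ★⁵ is Σ★⁗ with the conjunct `2 ∣ N` REMOVED from the negated Shimura-row clause, so the clause excludes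
more rows; given the data of a Σ★⁵ instance one decides `2 ∣ N` — if it holds the Σ★⁗ binder is available verbatim, if it fails the
Σ★⁗ binder holds vacuously). [cite: Jetchev2008, Conj. 1.3 (p. 812)] -/
theorem sigmaStarOptOffShimuraRowsAny_of_sigmaStarOptOffShimuraRows
    (hStar : ∀ (W : WeierstrassCurve ℚ) [W.IsElliptic] [W.IsGloballyMinimal] (N : ℕ) [NeZero N]
      (K : Type) [Field K] [NumberField K]
      (Dt : ModularParametrizationData W N) (H : HeegnerDatum N (NumberField.discr K)) (ι : K →+* ℂ)
      (P : (W.baseChange K).toAffine.Point),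
      ¬ W.HasCM → Addv W 3 → SubGss W 3 → W.conductorNorm ℤ = N →
      (∀ z ∈ Dt.L.lattice, ∃ w ∈ periodLattice Dt.f, z = Dt.c * w) →
      ¬ (∃ (q : ℕ) (_ : Fact q.Prime), q ∣ N ∧
          padicValNat 3 W.tamagawaProduct ≤ padicValNat 3 ((W.baseChange ℚ_[q]).localTamagawaNumber ℤ_[q])) →
      ¬ (2 ∣ N ∧
          (∀ (q : ℕ) [Fact q.Prime], 3 ∣ (W.baseChange ℚ_[q]).localTamagawaNumber ℤ_[q] →
            W.HasSplitMultiplicativeReductionAtPrime q) ∧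
          ∃ S : Finset ℕ, Even S.card ∧ (∀ ℓ ∈ S, ∃ _ : Fact ℓ.Prime, W.HasMultiplicativeReductionAtPrime ℓ) ∧
            (∀ (ℓ : ℕ) [Fact ℓ.Prime], ℓ ∉ S → W.HasSplitMultiplicativeReductionAtPrime ℓ →
              ¬ 3 ∣ padicValInt ℓ W.minimalDiscriminantInt) ∧
            ((∃ ℓ₀ ∈ S, ¬ 3 ∣ padicValInt ℓ₀ W.minimalDiscriminantInt) ∨
              (∃ ℓ₀ t : ℕ, ∃ _ : Fact ℓ₀.Prime, ∃ _ : Fact t.Prime,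
                W.HasMultiplicativeReductionAtPrime ℓ₀ ∧ W.HasMultiplicativeReductionAtPrime t ∧
                ℓ₀ ∉ S ∧ t ∉ S ∧ t ≠ ℓ₀ ∧ ¬ 3 ∣ padicValInt ℓ₀ W.minimalDiscriminantInt) ∨
              (∃ q₁ q₂ : ℕ, S = {q₁, q₂} ∧ q₁ ≠ q₂ ∧ q₂ ≠ 2 ∧ q₂ % 3 ≠ 1))) →
      IsImaginaryQuadratic K → SatisfiesHeegnerHypothesis N K →
      (WeierstrassCurve.Affine.Point.map ι.toRatAlgHom) P = heegnerPointComplex Dt H →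
      ¬ IsOfFinAddOrder P → Odd (NumberField.discr K) →
      ∀ (s' : ℕ), s' ≤ padicValNat 3 W.tamagawaProduct + padicValNat 3 Dt.c.natAbs →
      ∀ (n : ℕ) (d : KolyvaginHeegnerData Dt H.β ι n), Squarefree n →
      (∀ ℓ ∈ n.primeFactors, Zhang2014.IsKolyvaginPrime N W K 3 ℓ ∧ s' ≤ Zhang2014.kolyvaginIndex W 3 ℓ) →
      Koly.PDiv d 3 s') :
    ∀ (W : WeierstrassCurve ℚ) [W.IsElliptic] [W.IsGloballyMinimal] (N : ℕ) [NeZero N]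
      (K : Type) [Field K] [NumberField K]
      (Dt : ModularParametrizationData W N) (H : HeegnerDatum N (NumberField.discr K)) (ι : K →+* ℂ)
      (P : (W.baseChange K).toAffine.Point),
      ¬ W.HasCM → Addv W 3 → SubGss W 3 → W.conductorNorm ℤ = N →
      (∀ z ∈ Dt.L.lattice, ∃ w ∈ periodLattice Dt.f, z = Dt.c * w) →
      ¬ (∃ (q : ℕ) (_ : Fact q.Prime), q ∣ N ∧
          padicValNat 3 W.tamagawaProduct ≤ padicValNat 3 ((W.baseChange ℚ_[q]).localTamagawaNumber ℤ_[q])) →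
      ¬ ((∀ (q : ℕ) [Fact q.Prime], 3 ∣ (W.baseChange ℚ_[q]).localTamagawaNumber ℤ_[q] →
            W.HasSplitMultiplicativeReductionAtPrime q) ∧
          ∃ S : Finset ℕ, Even S.card ∧ (∀ ℓ ∈ S, ∃ _ : Fact ℓ.Prime, W.HasMultiplicativeReductionAtPrime ℓ) ∧
            (∀ (ℓ : ℕ) [Fact ℓ.Prime], ℓ ∉ S → W.HasSplitMultiplicativeReductionAtPrime ℓ →
              ¬ 3 ∣ padicValInt ℓ W.minimalDiscriminantInt) ∧
            ((∃ ℓ₀ ∈ S, ¬ 3 ∣ padicValInt ℓ₀ W.minimalDiscriminantInt) ∨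
              (∃ ℓ₀ t : ℕ, ∃ _ : Fact ℓ₀.Prime, ∃ _ : Fact t.Prime,
                W.HasMultiplicativeReductionAtPrime ℓ₀ ∧ W.HasMultiplicativeReductionAtPrime t ∧
                ℓ₀ ∉ S ∧ t ∉ S ∧ t ≠ ℓ₀ ∧ ¬ 3 ∣ padicValInt ℓ₀ W.minimalDiscriminantInt) ∨
              (∃ q₁ q₂ : ℕ, S = {q₁, q₂} ∧ q₁ ≠ q₂ ∧ q₂ ≠ 2 ∧ q₂ % 3 ≠ 1))) →
      IsImaginaryQuadratic K → SatisfiesHeegnerHypothesis N K →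
      (WeierstrassCurve.Affine.Point.map ι.toRatAlgHom) P = heegnerPointComplex Dt H →
      ¬ IsOfFinAddOrder P → Odd (NumberField.discr K) →
      ∀ (s' : ℕ), s' ≤ padicValNat 3 W.tamagawaProduct + padicValNat 3 Dt.c.natAbs →
      ∀ (n : ℕ) (d : KolyvaginHeegnerData Dt H.β ι n), Squarefree n →
      (∀ ℓ ∈ n.primeFactors, Zhang2014.IsKolyvaginPrime N W K 3 ℓ ∧ s' ≤ Zhang2014.kolyvaginIndex W 3 ℓ) →
      Koly.PDiv d 3 s' := by
  intro W _ _ N _ K _ _ Dt H ι P hCM hadd hsub hN hopt hrow hSh hK hHN hP hnt hodd s' hs' n d hn hℓ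
  refine hStar W N K Dt H ι P hCM hadd hsub hN hopt hrow ?_ hK hHN hP hnt hodd s' hs' n d hn hℓ
  rintro ⟨-, hshape, hS⟩
  exact hSh ⟨hshape, hS⟩

/-- **`LeafRankOneUpperAtThree` ⟸ PUB⁺ ∧ F1–F3 ∧ SHIMURA FACTS (split supply) ∧ Σ★⁵ ∧ L₀ — the composition of skeleton v10**
(conclusion literally the route decl). As part 3 §4 with the Shimura branch served WITHOUT `2 ∣ N` by part 4's
`leafRankOneUpper_three_of_shimuraInert_of_lowerRankZero_of_splitSupply` and the twist supply
`friedbergHoffstein_exists_twist_ne_zero_inertAt_splitAt` (Literature, p652724). Proof: optimal member `W₀ ∼ W`; at `W₀`: Shimura row ⇒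
part 4; else mono-carrier row ⇒ the any-carrier reading from F1–F3; else Σ★⁵ at the datum; transport back (Cassels + GZK).
CONDITIONAL on every displayed input; U₁ stays OPEN; BSD is not proved. [cite: JetchevSkinnerWan2017, §7.4.2 (p. 31), Thm. 4.4.1 (p. 19)]
[cite: CaiShuTian2014, Thm. 1.5] [cite: PastenShimura2024, Prop. 6.13, Lemmas 6.15–6.16, 6.18 (pp. 23–25)]
[cite: Jetchev2008, Conj. 1.3, Thm. 1.4 (p. 812)] [cite: GrossLMS1991, Prop. 3.7 (2) (p. 240)] [cite: MatarNekovar2019, Thm. 0.7 (p. 456)]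
[cite: FriedbergHoffstein1995, Thm. B] [cite: Mazur1978, Cor. 4.1] [cite: MilneADT2006, Thm. I.7.3] [cite: Miller2011LMS, Def. 1.1] -/
theorem leafRankOneUpperAtThree_of_pubManin_of_namedFacts_of_shimuraFactsSplit_of_sigmaStarOptOffShimuraRowsAny_of_lowerRankZero
    (hpub : LeafRankOnePrintedInputsAtThree)
    (h37 : GrossLMS1991.prop37_2_frobeniusCongruence)
    (hPT : ∀ (K : Type) [Field K] [NumberField K],
      Literature.NumberTheory.GaloisCohomology.poitouTate_selmerStructure_duality_conj K)
    (hF1 : Gross1991_heegnerPoint_sub_ratTorsion_mem_E0_imageFree)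
    (hJL : nonempty_shimuraParametrizationData) (hCO : PastenShimura2024_componentOrders)
    (hHK : shimuraCurve_heegnerPoint_grossZagier_kolyvagin)
    (hFH2 : friedbergHoffstein_exists_twist_ne_zero_inertAt_splitAt)
    (hStar : ∀ (W : WeierstrassCurve ℚ) [W.IsElliptic] [W.IsGloballyMinimal] (N : ℕ) [NeZero N]
      (K : Type) [Field K] [NumberField K]
      (Dt : ModularParametrizationData W N) (H : HeegnerDatum N (NumberField.discr K)) (ι : K →+* ℂ)
      (P : (W.baseChange K).toAffine.Point),
      ¬ W.HasCM → Addv W 3 → SubGss W 3 → W.conductorNorm ℤ = N →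
      (∀ z ∈ Dt.L.lattice, ∃ w ∈ periodLattice Dt.f, z = Dt.c * w) →
      ¬ (∃ (q : ℕ) (_ : Fact q.Prime), q ∣ N ∧
          padicValNat 3 W.tamagawaProduct ≤ padicValNat 3 ((W.baseChange ℚ_[q]).localTamagawaNumber ℤ_[q])) →
      ¬ ((∀ (q : ℕ) [Fact q.Prime], 3 ∣ (W.baseChange ℚ_[q]).localTamagawaNumber ℤ_[q] →
            W.HasSplitMultiplicativeReductionAtPrime q) ∧
          ∃ S : Finset ℕ, Even S.card ∧ (∀ ℓ ∈ S, ∃ _ : Fact ℓ.Prime, W.HasMultiplicativeReductionAtPrime ℓ) ∧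
            (∀ (ℓ : ℕ) [Fact ℓ.Prime], ℓ ∉ S → W.HasSplitMultiplicativeReductionAtPrime ℓ →
              ¬ 3 ∣ padicValInt ℓ W.minimalDiscriminantInt) ∧
            ((∃ ℓ₀ ∈ S, ¬ 3 ∣ padicValInt ℓ₀ W.minimalDiscriminantInt) ∨
              (∃ ℓ₀ t : ℕ, ∃ _ : Fact ℓ₀.Prime, ∃ _ : Fact t.Prime,
                W.HasMultiplicativeReductionAtPrime ℓ₀ ∧ W.HasMultiplicativeReductionAtPrime t ∧
                ℓ₀ ∉ S ∧ t ∉ S ∧ t ≠ ℓ₀ ∧ ¬ 3 ∣ padicValInt ℓ₀ W.minimalDiscriminantInt) ∨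
              (∃ q₁ q₂ : ℕ, S = {q₁, q₂} ∧ q₁ ≠ q₂ ∧ q₂ ≠ 2 ∧ q₂ % 3 ≠ 1))) →
      IsImaginaryQuadratic K → SatisfiesHeegnerHypothesis N K →
      (WeierstrassCurve.Affine.Point.map ι.toRatAlgHom) P = heegnerPointComplex Dt H →
      ¬ IsOfFinAddOrder P → Odd (NumberField.discr K) →
      ∀ (s' : ℕ), s' ≤ padicValNat 3 W.tamagawaProduct + padicValNat 3 Dt.c.natAbs →
      ∀ (n : ℕ) (d : KolyvaginHeegnerData Dt H.β ι n), Squarefree n →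
      (∀ ℓ ∈ n.primeFactors, Zhang2014.IsKolyvaginPrime N W K 3 ℓ ∧ s' ≤ Zhang2014.kolyvaginIndex W 3 ℓ) →
      Koly.PDiv d 3 s')
    (hL0 : Gss2LowerAtThreeRankZero) :
    LeafRankOneUpperAtThree := by
  intro W _ _ hCM hadd hsub hr
  obtain ⟨hGZ, hKo, hGZK, hmod, hGZ73, hMN, hnf, hFH, -, hCassels, hM, hAU, hC2⟩ := hpub
  haveI : Fact (Nat.Prime 3) := ⟨Nat.prime_three⟩
  have hR₂ := JetchevReadingAnyCarrier.anyCarrierTwoSplitReading_of_namedFacts h37 hPT hF1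
  obtain ⟨W₀, hW₀, hW₀', N, hN0, D₀, hiso, hN₀, -, hopt, hCM₀, hadd₀, hsub₀, hr₀⟩ :=
    exists_optimal_leaf_member hnf W hCM hadd hsub
  haveI := hW₀
  haveI := hW₀'
  haveI := hN0
  have hr₀' : W₀.analyticRank = 1 := hr₀.trans hr
  -- settle U₁ at the optimal member `W₀` by the three-way row split
  have h₀ : MissingUpperBoundAt W₀ 3 := by
    subst hN₀
    have hc : ¬ (3 : ℤ) ∣ D₀.c := not_three_dvd_c_of_latticeOptimal_of_subGss hM hAU hC2 hnf W₀ D₀ hopt hadd₀ hsub₀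
    by_cases hSh : ((∀ (q : ℕ) [Fact q.Prime], 3 ∣ (W₀.baseChange ℚ_[q]).localTamagawaNumber ℤ_[q] →
            W₀.HasSplitMultiplicativeReductionAtPrime q) ∧
          ∃ S : Finset ℕ, Even S.card ∧ (∀ ℓ ∈ S, ∃ _ : Fact ℓ.Prime, W₀.HasMultiplicativeReductionAtPrime ℓ) ∧
            (∀ (ℓ : ℕ) [Fact ℓ.Prime], ℓ ∉ S → W₀.HasSplitMultiplicativeReductionAtPrime ℓ →
              ¬ 3 ∣ padicValInt ℓ W₀.minimalDiscriminantInt) ∧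
            ((∃ ℓ₀ ∈ S, ¬ 3 ∣ padicValInt ℓ₀ W₀.minimalDiscriminantInt) ∨
              (∃ ℓ₀ t : ℕ, ∃ _ : Fact ℓ₀.Prime, ∃ _ : Fact t.Prime,
                W₀.HasMultiplicativeReductionAtPrime ℓ₀ ∧ W₀.HasMultiplicativeReductionAtPrime t ∧
                ℓ₀ ∉ S ∧ t ∉ S ∧ t ≠ ℓ₀ ∧ ¬ 3 ∣ padicValInt ℓ₀ W₀.minimalDiscriminantInt) ∨
              (∃ q₁ q₂ : ℕ, S = {q₁, q₂} ∧ q₁ ≠ q₂ ∧ q₂ ≠ 2 ∧ q₂ % 3 ≠ 1)))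
    · -- a Shimura row: the inert-carrier road (part 4), no Σ
      obtain ⟨hshape, S, hSeven, hSmult, hFC, hDEG⟩ := hSh
      exact leafRankOneUpper_three_of_shimuraInert_of_lowerRankZero_of_splitSupply hGZK hmod hnf hJL hCO hHK hFH2 hL0 W₀ hCM₀
        hadd₀ hsub₀ hr₀' rfl D₀ hc S hSeven hSmult hFC hshape hDEG
    · by_cases hrow : ∃ (q : ℕ) (_ : Fact q.Prime), q ∣ W₀.conductorNorm ℤ ∧
          padicValNat 3 W₀.tamagawaProduct ≤ padicValNat 3 ((W₀.baseChange ℚ_[q]).localTamagawaNumber ℤ_[q])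
      · -- a mono-carrier row: the any-carrier reading from F1–F3
        obtain ⟨q, _, hqN, hmono⟩ := hrow
        exact leafRankOneUpper_three_monoCarrierAny_of_anyCarrierReading_of_lowerRankZero hGZ hKo hGZK hmod hGZ73 hMN hnf
          hFH hR₂ hL0 W₀ hCM₀ hadd₀ hsub₀ hr₀' q hqN hmono D₀ hc
      · -- the research residue Σ★⁵ at the datum
        exact leafRankOneUpper_three_of_sigmaAtDatum_of_lowerRankZero hGZ hKo hGZK hmod hGZ73 hMN hnf hFH hL0 W₀ hCM₀ hadd₀
          hsub₀ hr₀' D₀ (fun K _ _ H ι P hK hHN _ hP hnt hodd s' hs' n d hn hℓ ↦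
            hStar W₀ (W₀.conductorNorm ℤ) K D₀ H ι P hCM₀ hadd₀ hsub₀ rfl hopt hrow hSh hK hHN hP hnt hodd s' hs' n d hn hℓ)
  -- and transport it back along `W ∼ W₀`
  exact missingUpperBoundAt_of_isIsogenous_of_analyticRank_le_one hCassels hGZK hmod (le_of_eq hr) hiso h₀

end Summit.BirchSwinnertonDyer.BirchSwinnertonDyer.Theorems.LeafShimuraInert

end
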